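import Literature.MathematicalPhysics.QuantumFieldTheory.Balaban1983to89.T4ShellMeasureAnalytic

/-!
# `T4Continuum.ShellMeasureRayWiring` — SM-L4 WIRING: END-II's non-Wilson ray binder `hE` from PER-TERM
# analyticity–oscillation pairs of printed TYPE, summed over the terms
# (cell `pub-balaban`, sub-cell `t4`, spine estimate NE7c (node U5b); ROUND-2 crew seat
# `b2b-balaban-t4-ne7c-formalise-leaf-05`, companion of the locator `XREAD-SM-L4-B12Thm1.md` (crew row S6);
# ADDITIVE — imports the Literature leaf `T4ShellMeasureAnalytic` (Cauchy estimates on a segment) only)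

HONEST FRAMING.  Finite four-torus programme, rung (B)+1 only — NOT infinite volume, NOT a mass gap, NOT the Clay
problem, NOT summit progress; (B), `BetaPertHyp`, (B^μ) are not consumed.  NE7c is NOT PRINTED as a theorem in
[Balaban 1983–89] and NOT proved; the cell wall (M1) is NOT moved.  This file is [folklore] kernel plumbing (Cauchy
estimate + mean value inequality + finite sums), 0 sorry, 0 citations; NOTHING of Bałaban's effective actions,
minimisers or their analyticity pairs is asserted or instantiated.  HONEST DEPENDENCY (cell): continuum YM on T⁴ ⇐
BetaPertH ∧ nine spine estimates (0/9 proved); BetaPertH ⇐ (D1) ∧ (D4) ∧ CAP+tail; G-an2-4 gates asym, D1 and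
NE2/3/4.

THE POINT.  END-II (`ShellMeasureRootCompositionSU2.slotAC_realized_su2_of_levelData`, via
`ShellMeasureLevelAssembly.slotAntiConcentration_of_levelData`) carries the non-Wilson part `𝓔` of the sectioned
log-weight through ONE binder
`hE : ∀ x ∈ W, ∀ c, 1/2 ≤ c → c ≤ 1 → 𝓔 (c • x) ≤ 𝓔 x + (1 − c) * B𝓔` (+ `0 ≤ B𝓔`).
The crew-row-S6 locator (GAPS G-ne7cL05-1) found: what print DISPLAYS toward it is PER TERM — for each localized
piece `𝐄^{(j)}(X,·) ∕ 𝐑^{(j)}(X,·) ∕ 𝐁^{(j)}(X,·)` an analyticity–boundedness pair on its complex domain ([Balaban1987RG1]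
(1.18) on `U^c_j(X, α₀, α₁)`, [Balaban1988Convergent] (2.31), (2.42)) and the composite analyticity through the
localized minimiser along a one-parameter complexified perturbation ([Balaban1987RG1] Lemma 4 (3.53), used as the
one-parameter disc bound (3.54)) — while the pair for the SUM along the block contraction is NOT PRINTED, and the
usable bound is an OSCILLATION sum (only `f′` enters a Cauchy argument, so `f − f(0)` per term is free).  This file
is the kernel statement of exactly that reduction, in the binder's own currency (window normalised to reach `1`,
radius `R > 1` in window units):
* §1 `norm_sub_le_of_analytic` ∕ `_osc`: ONE term — `f : ℂ → F` complex differentiable on `‖w‖ < R`, `R > 1`, with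
  `‖f‖ ≤ H` (resp. `‖f − f 0‖ ≤ H`) there ⇒ `‖f c − f 1‖ ≤ (1 − c)·3H/(R − 1)` for `c ∈ [0, 1]`
  (`T4ShellMeasureAnalytic.cauchy_bounds_on_segment` with `x₀ = 1` + the mean value inequality on `[c, 1]`);
* §2 `norm_sum_sub_le_of_analytic_osc`: a FINITE SUM of such terms with per-term oscillation bounds `H_i` ⇒ the same
  with `Σ H_i` — the oscillations ADD, the radius is the common one;
* §3 `rayBound_of_analytic_terms`: the END-II SHAPE — if for every window point `x ∈ W` the ray `c ↦ 𝓔 (c • x)` on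
  `[0,1]` is the real part of a finite sum of such terms with `Σ_i H_i(x) ≤ H̄`, then LITERALLY
  `∀ x ∈ W, ∀ c, 1/2 ≤ c → c ≤ 1 → 𝓔 (c • x) ≤ 𝓔 x + (1 − c) * (3 H̄ / (R − 1))`, and `0 ≤ 3 H̄/(R − 1)`
  (`rayConst_nonneg`) — i.e. END-II's `hE`∕`hB𝓔` with `B𝓔 = 3H̄/(R − 1)`, from per-term binders of printed TYPE.
So a seat that wants to SHRINK `hE` to printed type replaces it by: a common radius `R > 1` (window reach below the
analyticity radius — located READING, G-ne7cL05-1 (i)), per-term analytic extensions along the chart ray (Lemma 4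
TYPE), per-term oscillation bounds and their sum `H̄` (NOT PRINTED as a number, G-ne7cL05-1 (ii); by kind polynomial
in the level index, absorbed downstream by `T4ShellMeasureAnalytic.exists_pow_mul_pow_le`).  Nothing is discharged.

WHAT THIS DOES NOT DO.  No instance of any pair for Bałaban's terms; no claim about the radius in window units; the
fluctuation operations `T_k` ([Balaban1988Convergent] (2.19)–(2.22)) are not touched; (LR), (MR), (W1), the
(F∞)-rate keep their status; NE7c NOT proved; 0/9 spine.
-/

namespace Summit.QuantumFields.BalabanUV.T4Continuum.ShellMeasureRayWiring

open Set Metric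
open Literature.MathematicalPhysics.QuantumFieldTheory.Balaban1983to89
open T4ShellMeasureAnalytic (cauchy_bounds_on_segment)

/-! ## §1 One term: the ray difference from an analyticity–boundedness ∕ –oscillation pair -/

section OneTerm

variable {F : Type*} [NormedAddCommGroup F] [NormedSpace ℂ F] [CompleteSpace F]

/-- **ONE TERM, SUP FORM.**  If `f : ℂ → F` is complex differentiable on the ball `‖w‖ < R`, `R > 1`, with `‖f w‖ ≤ H`
there, then along the real segment `‖f c − f 1‖ ≤ (1 − c)·3H/(R − 1)` for `0 ≤ c ≤ 1`: the Cauchy bound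
`‖f′‖ ≤ 3H/(R − 1)` on `[−1, 1]` (`cauchy_bounds_on_segment`, `x₀ = 1`) integrated over `[c, 1]`. [folklore] -/
theorem norm_sub_le_of_analytic {f : ℂ → F} {R H : ℝ} (hR : 1 < R)
    (hf : DifferentiableOn ℂ f (ball 0 R)) (hH : ∀ w ∈ ball (0 : ℂ) R, ‖f w‖ ≤ H)
    {c : ℝ} (hc0 : 0 ≤ c) (hc1 : c ≤ 1) :
    ‖f (c : ℂ) - f 1‖ ≤ (1 - c) * (3 * H / (R - 1)) := by
  have hcs := cauchy_bounds_on_segment (x₀ := (1 : ℝ)) zero_le_one hR hf hH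
  have hd : ∀ t ∈ Icc c 1, HasDerivWithinAt (fun y : ℝ => f y) (deriv f t) (Icc c 1) t := fun t ht =>
    (hcs t (abs_le.2 ⟨by linarith [ht.1], ht.2⟩)).1.hasDerivWithinAt
  have hb : ∀ t ∈ Ico c 1, ‖deriv f t‖ ≤ 3 * H / (R - 1) := fun t ht =>
    (hcs t (abs_le.2 ⟨by linarith [ht.1], ht.2.le⟩)).2.2.1
  have h := norm_image_sub_le_of_norm_deriv_le_segment' hd hb 1 (right_mem_Icc.2 hc1)
  simp only [Complex.ofReal_one] at h
  rw [norm_sub_rev]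
  linarith [h]

/-- **ONE TERM, OSCILLATION FORM.**  The same with the weaker datum `‖f w − f 0‖ ≤ H` on the ball (only `f′` enters;
apply the sup form to `f − f 0`). [folklore] -/
theorem norm_sub_le_of_analytic_osc {f : ℂ → F} {R H : ℝ} (hR : 1 < R)
    (hf : DifferentiableOn ℂ f (ball 0 R)) (hH : ∀ w ∈ ball (0 : ℂ) R, ‖f w - f 0‖ ≤ H)
    {c : ℝ} (hc0 : 0 ≤ c) (hc1 : c ≤ 1) :
    ‖f (c : ℂ) - f 1‖ ≤ (1 - c) * (3 * H / (R - 1)) := by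
  have h := norm_sub_le_of_analytic (f := fun w => f w - f 0) hR (hf.sub_const _) hH hc0 hc1
  simpa only [sub_sub_sub_cancel_right] using h

omit [NormedSpace ℂ F] [CompleteSpace F] in
/-- the oscillation datum forces `0 ≤ H` (read it at the centre). [folklore] -/
theorem osc_nonneg {f : ℂ → F} {R H : ℝ} (hR : 0 < R) (hH : ∀ w ∈ ball (0 : ℂ) R, ‖f w - f 0‖ ≤ H) :
    0 ≤ H := by
  simpa using hH 0 (mem_ball_self hR)

end OneTerm

/-! ## §2 Finite sums: the oscillations add, the radius is the common one -/

section Sums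

variable {F : Type*} [NormedAddCommGroup F] [NormedSpace ℂ F] [CompleteSpace F]

/-- **FINITE SUM OF TERMS, OSCILLATION FORM.**  Terms `f i`, `i ∈ I`, each complex differentiable on `‖w‖ < R`
(`R > 1`) with `‖f i w − f i 0‖ ≤ H i` there ⇒ `‖Σ_i f i c − Σ_i f i 1‖ ≤ (1 − c)·3(Σ_i H i)/(R − 1)` on `[0,1]`.
[folklore] -/
theorem norm_sum_sub_le_of_analytic_osc {ι : Type*} (I : Finset ι) {f : ι → ℂ → F} {R : ℝ} {H : ι → ℝ}
    (hR : 1 < R) (hf : ∀ i ∈ I, DifferentiableOn ℂ (f i) (ball 0 R))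
    (hH : ∀ i ∈ I, ∀ w ∈ ball (0 : ℂ) R, ‖f i w - f i 0‖ ≤ H i) {c : ℝ} (hc0 : 0 ≤ c) (hc1 : c ≤ 1) :
    ‖∑ i ∈ I, f i (c : ℂ) - ∑ i ∈ I, f i 1‖ ≤ (1 - c) * (3 * (∑ i ∈ I, H i) / (R - 1)) := by
  have hF : DifferentiableOn ℂ (fun w => ∑ i ∈ I, f i w) (ball 0 R) := DifferentiableOn.fun_sum hf
  have hosc : ∀ w ∈ ball (0 : ℂ) R, ‖∑ i ∈ I, f i w - ∑ i ∈ I, f i 0‖ ≤ ∑ i ∈ I, H i := by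
    intro w hw
    rw [← Finset.sum_sub_distrib]
    exact (norm_sum_le _ _).trans (Finset.sum_le_sum fun i hi => hH i hi w hw)
  exact norm_sub_le_of_analytic_osc (f := fun w => ∑ i ∈ I, f i w) hR hF hosc hc0 hc1

/-- **FINITE SUM OF TERMS, SUP FORM** (per-term `‖f i w‖ ≤ H i`; no factor 2 is lost, the sup bounds also add).
[folklore] -/
theorem norm_sum_sub_le_of_analytic {ι : Type*} (I : Finset ι) {f : ι → ℂ → F} {R : ℝ} {H : ι → ℝ}
    (hR : 1 < R) (hf : ∀ i ∈ I, DifferentiableOn ℂ (f i) (ball 0 R))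
    (hH : ∀ i ∈ I, ∀ w ∈ ball (0 : ℂ) R, ‖f i w‖ ≤ H i) {c : ℝ} (hc0 : 0 ≤ c) (hc1 : c ≤ 1) :
    ‖∑ i ∈ I, f i (c : ℂ) - ∑ i ∈ I, f i 1‖ ≤ (1 - c) * (3 * (∑ i ∈ I, H i) / (R - 1)) := by
  have hF : DifferentiableOn ℂ (fun w => ∑ i ∈ I, f i w) (ball 0 R) := DifferentiableOn.fun_sum hf
  have hsup : ∀ w ∈ ball (0 : ℂ) R, ‖∑ i ∈ I, f i w‖ ≤ ∑ i ∈ I, H i := fun w hw =>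
    (norm_sum_le _ _).trans (Finset.sum_le_sum fun i hi => hH i hi w hw)
  exact norm_sub_le_of_analytic (f := fun w => ∑ i ∈ I, f i w) hR hF hsup hc0 hc1

end Sums

/-! ## §3 The END-II shape: `hE` ∕ `hB𝓔` from per-term pairs along the chart ray -/

section EndTwoShape

variable {E : Type*} [AddCommGroup E] [Module ℝ E]

/-- the constant is nonnegative (END-II's `hB𝓔`). [folklore] -/
theorem rayConst_nonneg {R Hbar : ℝ} (hR : 1 < R) (hHbar : 0 ≤ Hbar) : 0 ≤ 3 * Hbar / (R - 1) :=
  div_nonneg (by positivity) (by linarith)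

/-- **SM-L4 WIRING — END-II's `hE` FROM PER-TERM ANALYTICITY–OSCILLATION PAIRS.**  Data per window point `x ∈ W`:
finitely many terms `g x i : ℂ → ℂ`, `i ∈ I x`, complex differentiable on the common disc `‖w‖ < R` (`R > 1`,
window units) with oscillation bounds `‖g x i w − g x i 0‖ ≤ H x i`, `Σ_{i∈I x} H x i ≤ H̄`, whose sum has real part
`𝓔 (c • x)` along the real segment `c ∈ [0,1]`.  CONCLUSION, literally the binder of
`ShellMeasureLevelAssembly.slotAntiConcentration_of_levelData` ∕ END-II:
`∀ x ∈ W, ∀ c, 1/2 ≤ c → c ≤ 1 → 𝓔 (c • x) ≤ 𝓔 x + (1 − c) * (3 H̄ / (R − 1))`.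
(The per-term data are of the printed TYPE [Balaban1987RG1] Lemma 4 (3.53)–(3.54) + (1.18) ∕ [Balaban1988Convergent]
(2.31), (2.42); for Bałaban's terms they are located, NOT PRINTED as instances — GAPS G-ne7cL05-1; nothing is
instantiated here.) [folklore] -/
theorem rayBound_of_analytic_terms {𝓔 : E → ℝ} {W : Set E} {ι : Type*} (I : E → Finset ι)
    {g : E → ι → ℂ → ℂ} {R : ℝ} {H : E → ι → ℝ} {Hbar : ℝ} (hR : 1 < R)
    (hg : ∀ x ∈ W, ∀ i ∈ I x, DifferentiableOn ℂ (g x i) (ball 0 R))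
    (hosc : ∀ x ∈ W, ∀ i ∈ I x, ∀ w ∈ ball (0 : ℂ) R, ‖g x i w - g x i 0‖ ≤ H x i)
    (hsum : ∀ x ∈ W, ∑ i ∈ I x, H x i ≤ Hbar)
    (hreal : ∀ x ∈ W, ∀ c : ℝ, 0 ≤ c → c ≤ 1 → (∑ i ∈ I x, g x i (c : ℂ)).re = 𝓔 (c • x)) :
    ∀ x ∈ W, ∀ c : ℝ, 1 / 2 ≤ c → c ≤ 1 → 𝓔 (c • x) ≤ 𝓔 x + (1 - c) * (3 * Hbar / (R - 1)) := by
  intro x hx c hc hc1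
  have hc0 : 0 ≤ c := by linarith
  have h := norm_sum_sub_le_of_analytic_osc (I x) hR (hg x hx) (hosc x hx) hc0 hc1
  have hmono : (1 - c) * (3 * (∑ i ∈ I x, H x i) / (R - 1)) ≤ (1 - c) * (3 * Hbar / (R - 1)) := by
    have hR1 : 0 < R - 1 := by linarith
    have h1c : 0 ≤ 1 - c := by linarith
    exact mul_le_mul_of_nonneg_left (div_le_div_of_nonneg_right (by linarith [hsum x hx]) hR1.le) h1c
  have hre : (∑ i ∈ I x, g x i (c : ℂ)).re - (∑ i ∈ I x, g x i 1).re ≤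
      ‖∑ i ∈ I x, g x i (c : ℂ) - ∑ i ∈ I x, g x i 1‖ := by
    rw [← Complex.sub_re]
    exact (le_abs_self _).trans (Complex.abs_re_le_norm _)
  have h1 : (∑ i ∈ I x, g x i 1).re = 𝓔 x := by
    have := hreal x hx 1 zero_le_one le_rfl
    rw [Complex.ofReal_one, one_smul] at this
    exact this
  rw [hreal x hx c hc0 hc1, h1] at hre
  linarith

/-- the ONE-TERM case of `rayBound_of_analytic_terms` (one analytic `g x` per window point, oscillation `≤ H̄`).
[folklore] -/
theorem rayBound_of_analytic {𝓔 : E → ℝ} {W : Set E} {g : E → ℂ → ℂ} {R Hbar : ℝ} (hR : 1 < R)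
    (hg : ∀ x ∈ W, DifferentiableOn ℂ (g x) (ball 0 R))
    (hosc : ∀ x ∈ W, ∀ w ∈ ball (0 : ℂ) R, ‖g x w - g x 0‖ ≤ Hbar)
    (hreal : ∀ x ∈ W, ∀ c : ℝ, 0 ≤ c → c ≤ 1 → (g x (c : ℂ)).re = 𝓔 (c • x)) :
    ∀ x ∈ W, ∀ c : ℝ, 1 / 2 ≤ c → c ≤ 1 → 𝓔 (c • x) ≤ 𝓔 x + (1 - c) * (3 * Hbar / (R - 1)) := by
  refine rayBound_of_analytic_terms (ι := Unit) (fun _ => {()}) (g := fun x _ => g x) (H := fun _ _ => Hbar) hR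
    (fun x hx _ _ => hg x hx) (fun x hx _ _ => hosc x hx) (fun x _ => by simp) fun x hx c hc0 hc1 => ?_
  simpa using hreal x hx c hc0 hc1

/-- **BOTH BINDERS AT ONCE**, in the order END-II takes them (`hE`, then `hB𝓔`). [folklore] -/
theorem rayBinders_of_analytic_terms {𝓔 : E → ℝ} {W : Set E} {ι : Type*} (I : E → Finset ι)
    {g : E → ι → ℂ → ℂ} {R : ℝ} {H : E → ι → ℝ} {Hbar : ℝ} (hR : 1 < R) (hHbar : 0 ≤ Hbar)
    (hg : ∀ x ∈ W, ∀ i ∈ I x, DifferentiableOn ℂ (g x i) (ball 0 R))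
    (hosc : ∀ x ∈ W, ∀ i ∈ I x, ∀ w ∈ ball (0 : ℂ) R, ‖g x i w - g x i 0‖ ≤ H x i)
    (hsum : ∀ x ∈ W, ∑ i ∈ I x, H x i ≤ Hbar)
    (hreal : ∀ x ∈ W, ∀ c : ℝ, 0 ≤ c → c ≤ 1 → (∑ i ∈ I x, g x i (c : ℂ)).re = 𝓔 (c • x)) :
    (∀ x ∈ W, ∀ c : ℝ, 1 / 2 ≤ c → c ≤ 1 → 𝓔 (c • x) ≤ 𝓔 x + (1 - c) * (3 * Hbar / (R - 1))) ∧
      0 ≤ 3 * Hbar / (R - 1) :=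
  ⟨rayBound_of_analytic_terms I hR hg hosc hsum hreal, rayConst_nonneg hR hHbar⟩

end EndTwoShape

/-! ## §4 Non-vacuity: affine terms (a linear response to a frozen exterior per term) -/

section NonVacuity

/-- NON-VACUITY of §3 on the line `E = ℝ`: two affine terms `g x i w = a i + b i · w · x` (`i = 0, 1`) — each a
constant plus a LINEAR response along the ray — with `𝓔 y = Re(a 0 + a 1) + Re(b 0 + b 1)·y`, window `W = [−1, 1]`,
radius `R = 2`: the hypotheses hold with `H x i = 2‖b i‖`, `H̄ = 2(‖b 0‖ + ‖b 1‖)`, so the binder fires with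
`B𝓔 = 3·H̄/(2 − 1) = 6(‖b 0‖ + ‖b 1‖)`. [folklore] -/
example (a b : Fin 2 → ℂ) :
    ∀ x ∈ Icc (-1 : ℝ) 1, ∀ c : ℝ, 1 / 2 ≤ c → c ≤ 1 →
      (a 0 + a 1).re + (b 0 + b 1).re * (c • x) ≤
        ((a 0 + a 1).re + (b 0 + b 1).re * x) + (1 - c) * (3 * (2 * (‖b 0‖ + ‖b 1‖)) / (2 - 1)) := by
  have h := rayBound_of_analytic_terms (𝓔 := fun y : ℝ => (a 0 + a 1).re + (b 0 + b 1).re * y)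
    (W := Icc (-1 : ℝ) 1) (fun _ => (Finset.univ : Finset (Fin 2)))
    (g := fun x i w => a i + b i * w * x) (H := fun _ i => 2 * ‖b i‖) (R := 2) (Hbar := 2 * (‖b 0‖ + ‖b 1‖))
    one_lt_two (fun x _ i _ => ?_) (fun x hx i _ w hw => ?_) (fun x _ => ?_) (fun x _ c _ _ => ?_)
  · exact h
  · exact ((differentiable_const _).add
      (((differentiable_const _).mul differentiable_id).mul (differentiable_const _))).differentiableOn
  · rw [mem_ball_zero_iff] at hw
    have hx1 : |x| ≤ 1 := abs_le.2 hx
    calc ‖a i + b i * w * x - (a i + b i * 0 * x)‖ = ‖b i‖ * ‖w‖ * |x| := by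
          simp [Complex.norm_real]
      _ ≤ ‖b i‖ * 2 * 1 := by gcongr
      _ = 2 * ‖b i‖ := by ring
  · simp [Fin.sum_univ_two]
    ring_nf
    rfl
  · simp [Fin.sum_univ_two, smul_eq_mul]
    ring

end NonVacuity

end Summit.QuantumFields.BalabanUV.T4Continuum.ShellMeasureRayWiring
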